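import Summits.HubbardSuperconductivity.HubbardSuperconductivity.Theorems.KacWindowPenaltyWindowGapPenalisedForms
import Summits.HubbardSuperconductivity.HubbardSuperconductivity.Theorems.KacWindowPenaltyGlue

/-!
# Route `KacWindowPenalty` — crux `WindowGap` (stmt-HubbardSuperconductivity-1088):
# the FLOOR ∧ ROBUSTNESS split, and what the route actually consumes

Companion of `…Theorems.KacWindowPenaltyWindowGapSummitSplit` (the ORDER ∧ ROBUSTNESS split in
minimiser form). This module records, definition-free and with no physics, the strategist census
v2 decomposition D7 (`Cruxes/WindowGap/STRATEGY-CENSUS.md` §Decomposition, typed companion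
`Cruxes/WindowGap/SketchStrategistS1.lean`) as tree facts. Notation (all spelled out in the
signatures): `H_L = hubbardTorus 2 L 1 U`, `K_L = szSector N_L 0`, `N_L = 2⌊(1−δ)L²/2⌋`,
`Δ_d(m) = pairFieldAt dWaveFormFactor L m`, the crux's Kac window
`W_ε = Σ_m [ |q_m| ≤ ε ] L⁻² • Δ_d(m)ᴴ Δ_d(m)` and window tail
`T_ε(ψ) = Σ_m [m ≠ 0 ∧ |q_m| ≤ ε] ‖Δ_d(m) ψ‖² / L²` (the route's `let D` / `let W` by `rfl`).

* the WINDOW FLOOR at `(U, δ)`: `∀ C ≥ 0 ∀ ε₀ > 0 ∃ ε ≤ ε₀ ∃ a > 0 ∃ L₀`, every normalised sector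
  ground state `ψ` of the PURE torus at every even `L ≥ L₀` has `(Cε + a) L² ≤ Re ⟨ψ, W_ε ψ⟩` — no
  penalty, no `λ`;
* `windowFloorAt_of_windowGapAt` / `exists_windowFloorAt_of_windowGap`: the crux body at `(U, δ)`
  implies the floor at `(U, δ)` (the route's sandwich `windowWeight_of_windowGapAt`), so
  `WindowGap` implies the floor at some `U > 0`, `δ ∈ (0, 1/2)`;
* `everyGSOrderAt_of_windowFloorAt_of_wibAt`: floor + the sibling crux's window tail bound at the
  same point give every-ground-state `d`-wave pair long-range order there, hence
  `hubbardSuperconductivity_of_windowFloorAt_of_wibAt` and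
  `hubbardSuperconductivity_of_exists_windowFloorAt_of_wib`: the route's deciding theorem
  `closes (hGap : WindowGap) (hIR : WindowInfraredBound) …` goes through with the WEAKER first
  binder "floor at some point" — the penalised-energy (stiffness) half of the crux is never consumed;
* `windowFloorAt_of_everyGSOrderAt`, `windowFloorAt_iff_summitMatrix_of_wibAt`: conversely every-GS
  order implies the floor, so GIVEN the sibling crux at the point the floor IS the summit's matrix
  at the point (the glue FLOOR → (∀ (U, δ), FLOOR → GAP) → `WindowGap` of the split is the one-liner
  `⟨U, hU, δ, hδ, h2 U hU δ hδ hF⟩` and is not restated);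
* `windowGap_of_twoRegimeProfile` (census S7): the two-regime profile
  `λ · min m (κε²/λ) · L² ≤ gap + λ C ε L²` for all small `λ` implies the crux (its small-`λ` corner).

Reading (census D7, now a tree fact): `WindowGap = (summit at the point, given crux 3) ∧ (window
stiffness)`, and the route uses only the first conjunct. Supports for the crux
(`--supports stmt-HubbardSuperconductivity-1088`). D. J. Scalapino, Phys. Rep. 250 (1995) 329, §2;
H. Tasaki, *Physics and Mathematics of Quantum Many-Body Systems* (2020) §2.1. No new definitions;
nothing here is a line of attack on the crux.
-/

-- the mandated namespace `Summit.<Summit>.<Problem>.Theorems` repeats `HubbardSuperconductivity`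
-- (single-problem summit, D-0017), which the `dupNamespace` linter flags on every declaration
set_option linter.dupNamespace false

namespace Summit.HubbardSuperconductivity.HubbardSuperconductivity.Theorems

open Matrix Literature.MathematicalPhysics.QuantumLattice Literature.Probability.LatticeModels
open Summit.HubbardSuperconductivity.HubbardSuperconductivity.Theses.KacWindowPenalty
  (WindowGap WindowInfraredBound)
open Summit.HubbardSuperconductivity.TwTipContinuation.Negative
  (summitMatrix_of_everyGSOrder summitMatrix_iff_everyGSOrder)

/-! ### The crux body implies the window floor (the sandwich) -/

/-- **Gap at `(U, δ)` ⇒ window floor at `(U, δ)`.** If the crux body holds at `(U, δ)` (for every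
`C ≥ 0`, `ε₀ > 0` some `ε ≤ ε₀`, `λ, a > 0`, `L₀` with
`λ(Cε + a)L² ≤ minEnergyOn (H_L + λW_ε) K_L − minEnergyOn H_L K_L` at every even `L ≥ L₀`), then
every normalised sector ground state `ψ` of the pure torus has `(Cε + a)L² ≤ Re ⟨ψ, W_ε ψ⟩` with
the same `(ε, a, L₀)` — the route's sandwich `gap ≤ λ Re ⟨ψ₀, W_ε ψ₀⟩`
(`windowWeight_of_windowGapAt`), `λ` cancelled. Tasaki (2020) §2.1. [folklore] -/
theorem windowFloorAt_of_windowGapAt {U δ : ℝ}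
    (h : ∀ C : ℝ, 0 ≤ C → ∀ ε₀ : ℝ, 0 < ε₀ → ∃ ε ∈ Set.Ioc (0 : ℝ) ε₀, ∃ lam a : ℝ, 0 < lam ∧ 0 < a ∧
      ∃ L₀ : ℕ, ∀ (L : ℕ) [NeZero L], L₀ ≤ L → Even L →
        lam * (C * ε + a) * (L : ℝ) ^ 2 ≤
          (hubbardTorus 2 L 1 U + (lam : ℂ) • (∑ m : Fin 2 → ZMod L,
              if (2 * Real.pi / (L : ℝ)) ^ 2 * (∑ i : Fin 2, (((m i).valMinAbs : ℤ) : ℝ) ^ 2) ≤ ε ^ 2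
              then ((L : ℂ) ^ 2)⁻¹ • (Matrix.conjTranspose (pairFieldAt dWaveFormFactor L m) *
                pairFieldAt dWaveFormFactor L m)
              else 0)).minEnergyOn (szSector (2 * ⌊(1 - δ) * (L : ℝ) ^ 2 / 2⌋₊) 0) -
            (hubbardTorus 2 L 1 U).minEnergyOn (szSector (2 * ⌊(1 - δ) * (L : ℝ) ^ 2 / 2⌋₊) 0)) :
    ∀ C : ℝ, 0 ≤ C → ∀ ε₀ : ℝ, 0 < ε₀ → ∃ ε ∈ Set.Ioc (0 : ℝ) ε₀, ∃ a : ℝ, 0 < a ∧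
      ∃ L₀ : ℕ, ∀ (L : ℕ) [NeZero L], L₀ ≤ L → Even L →
        ∀ ψ : Fock (Orb (FermionTorus 2 L)), star ψ ⬝ᵥ ψ = 1 →
          IsGroundStateInSector (hubbardTorus 2 L 1 U) (2 * ⌊(1 - δ) * (L : ℝ) ^ 2 / 2⌋₊) 0 ψ →
            (C * ε + a) * (L : ℝ) ^ 2 ≤ (star ψ ⬝ᵥ (∑ m : Fin 2 → ZMod L,
              if (2 * Real.pi / (L : ℝ)) ^ 2 * (∑ i : Fin 2, (((m i).valMinAbs : ℤ) : ℝ) ^ 2) ≤ ε ^ 2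
              then ((L : ℂ) ^ 2)⁻¹ • (Matrix.conjTranspose (pairFieldAt dWaveFormFactor L m) *
                pairFieldAt dWaveFormFactor L m)
              else 0) *ᵥ ψ).re := by
  intro C hC ε₀ hε₀
  obtain ⟨ε, hε, lam, a, hlam, ha, L₀, hG⟩ := h C hC ε₀ hε₀
  refine ⟨ε, hε, a, ha, L₀, fun L _ hL hE ψ hψ hgs => ?_⟩
  have hgap := hG L hL hE
  have hgap' : lam * ((C * ε + a) * (L : ℝ) ^ 2) ≤
      (hubbardTorus 2 L 1 U + (lam : ℂ) • (∑ m : Fin 2 → ZMod L,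
          if (2 * Real.pi / (L : ℝ)) ^ 2 * (∑ i : Fin 2, (((m i).valMinAbs : ℤ) : ℝ) ^ 2) ≤ ε ^ 2
          then ((L : ℂ) ^ 2)⁻¹ • (Matrix.conjTranspose (pairFieldAt dWaveFormFactor L m) *
            pairFieldAt dWaveFormFactor L m)
          else 0)).minEnergyOn (szSector (2 * ⌊(1 - δ) * (L : ℝ) ^ 2 / 2⌋₊) 0) -
        (hubbardTorus 2 L 1 U).minEnergyOn (szSector (2 * ⌊(1 - δ) * (L : ℝ) ^ 2 / 2⌋₊) 0) := by
    calc lam * ((C * ε + a) * (L : ℝ) ^ 2) = lam * (C * ε + a) * (L : ℝ) ^ 2 := by ring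
      _ ≤ _ := hgap
  exact windowWeight_of_windowGapAt L U _ hlam hgap' hψ hgs

/-- **The crux implies its floor at some point**: `WindowGap` gives `U > 0`, `δ ∈ (0, 1/2)` at which
the window floor holds (`windowFloorAt_of_windowGapAt`; the route's `let D` / `let W` are
`pairFieldAt` / the spelled-out window by `rfl`). Tasaki (2020) §2.1. [folklore] -/
theorem exists_windowFloorAt_of_windowGap (h : WindowGap) :
    ∃ U : ℝ, 0 < U ∧ ∃ δ ∈ Set.Ioo (0 : ℝ) (1 / 2),
      ∀ C : ℝ, 0 ≤ C → ∀ ε₀ : ℝ, 0 < ε₀ → ∃ ε ∈ Set.Ioc (0 : ℝ) ε₀, ∃ a : ℝ, 0 < a ∧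
        ∃ L₀ : ℕ, ∀ (L : ℕ) [NeZero L], L₀ ≤ L → Even L →
          ∀ ψ : Fock (Orb (FermionTorus 2 L)), star ψ ⬝ᵥ ψ = 1 →
            IsGroundStateInSector (hubbardTorus 2 L 1 U) (2 * ⌊(1 - δ) * (L : ℝ) ^ 2 / 2⌋₊) 0 ψ →
              (C * ε + a) * (L : ℝ) ^ 2 ≤ (star ψ ⬝ᵥ (∑ m : Fin 2 → ZMod L,
                if (2 * Real.pi / (L : ℝ)) ^ 2 * (∑ i : Fin 2, (((m i).valMinAbs : ℤ) : ℝ) ^ 2) ≤ ε ^ 2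
                then ((L : ℂ) ^ 2)⁻¹ • (Matrix.conjTranspose (pairFieldAt dWaveFormFactor L m) *
                  pairFieldAt dWaveFormFactor L m)
                else 0) *ᵥ ψ).re := by
  obtain ⟨U, hU, δ, hδ, hG⟩ := h
  exact ⟨U, hU, δ, hδ, windowFloorAt_of_windowGapAt hG⟩

/-! ### What the route consumes: floor + tail at one point ⇒ every-GS order ⇒ summit -/

/-- **Floor + window tail bound at the same `(U, δ)` ⇒ every-ground-state `d`-wave LRO at `(U, δ)`.**
Take `(C, ε₀, L₁)` from the tail bound, then `(ε, a, L₀)` from the floor at `(C, ε₀)`; at even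
`L ≥ max L₀ L₁`, for every normalised sector ground state `ψ`:
`(Cε + a)L² ≤ Re ⟨ψ, W_ε ψ⟩ = ‖Δ_d(0)ψ‖²/L² + T_ε(ψ)` (`re_dotProduct_kacWindow_mulVec`, split at
`m = 0`, `pairFieldAt_zero`) and `T_ε(ψ) ≤ CεL²`, hence `a L⁴ ≤ Re ⟨ψ, Δ_dᴴ Δ_d ψ⟩`. The penalised
energy never enters: this is the whole use the route makes of crux `WindowGap`.
Scalapino, Phys. Rep. 250 (1995) §2 (2.4). [folklore] -/
theorem everyGSOrderAt_of_windowFloorAt_of_wibAt {U δ : ℝ}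
    (hF : ∀ C : ℝ, 0 ≤ C → ∀ ε₀ : ℝ, 0 < ε₀ → ∃ ε ∈ Set.Ioc (0 : ℝ) ε₀, ∃ a : ℝ, 0 < a ∧
      ∃ L₀ : ℕ, ∀ (L : ℕ) [NeZero L], L₀ ≤ L → Even L →
        ∀ ψ : Fock (Orb (FermionTorus 2 L)), star ψ ⬝ᵥ ψ = 1 →
          IsGroundStateInSector (hubbardTorus 2 L 1 U) (2 * ⌊(1 - δ) * (L : ℝ) ^ 2 / 2⌋₊) 0 ψ →
            (C * ε + a) * (L : ℝ) ^ 2 ≤ (star ψ ⬝ᵥ (∑ m : Fin 2 → ZMod L,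
              if (2 * Real.pi / (L : ℝ)) ^ 2 * (∑ i : Fin 2, (((m i).valMinAbs : ℤ) : ℝ) ^ 2) ≤ ε ^ 2
              then ((L : ℂ) ^ 2)⁻¹ • (Matrix.conjTranspose (pairFieldAt dWaveFormFactor L m) *
                pairFieldAt dWaveFormFactor L m)
              else 0) *ᵥ ψ).re)
    (hW : ∃ C ε₀ : ℝ, 0 ≤ C ∧ 0 < ε₀ ∧ ∃ L₀ : ℕ, ∀ ε ∈ Set.Ioc (0 : ℝ) ε₀, ∀ (L : ℕ) [NeZero L],
      L₀ ≤ L → Even L → ∀ ψ : Fock (Orb (FermionTorus 2 L)), star ψ ⬝ᵥ ψ = 1 →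
        IsGroundStateInSector (hubbardTorus 2 L 1 U) (2 * ⌊(1 - δ) * (L : ℝ) ^ 2 / 2⌋₊) 0 ψ →
          (∑ m : Fin 2 → ZMod L,
            if m ≠ 0 ∧
                (2 * Real.pi / (L : ℝ)) ^ 2 * (∑ i : Fin 2, (((m i).valMinAbs : ℤ) : ℝ) ^ 2) ≤ ε ^ 2 then
              (star (Matrix.mulVec (pairFieldAt dWaveFormFactor L m) ψ) ⬝ᵥ
                  Matrix.mulVec (pairFieldAt dWaveFormFactor L m) ψ).re / (L : ℝ) ^ 2
            else 0) ≤ C * ε * (L : ℝ) ^ 2) :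
    ∃ c : ℝ, 0 < c ∧ ∃ L₀ : ℕ, ∀ (L : ℕ) [NeZero L], L₀ ≤ L → Even L →
      ∀ ψ : Fock (Orb (FermionTorus 2 L)), star ψ ⬝ᵥ ψ = 1 →
        IsGroundStateInSector (hubbardTorus 2 L 1 U) (2 * ⌊(1 - δ) * (L : ℝ) ^ 2 / 2⌋₊) 0 ψ →
          c * (L : ℝ) ^ 4 ≤
            (expect ((pairField dWaveFormFactor L)ᴴ * pairField dWaveFormFactor L) ψ).re := by
  obtain ⟨C, ε₀, hC, hε₀, L₁, hI⟩ := hW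
  obtain ⟨ε, hε, a, ha, L₀, hFl⟩ := hF C hC ε₀ hε₀
  refine ⟨a, ha, max L₀ L₁, fun L _ hL hE ψ hψ1 hψ => ?_⟩
  have hLpos : (0 : ℝ) < (L : ℝ) := Nat.cast_pos.2 (Nat.pos_of_ne_zero (NeZero.ne L))
  have hL2 : (0 : ℝ) < (L : ℝ) ^ 2 := by positivity
  have hfloor := hFl L (le_of_max_le_left hL) hE ψ hψ1 hψ
  have htail := hI ε hε L (le_of_max_le_right hL) hE ψ hψ1 hψ
  rw [re_dotProduct_kacWindow_mulVec] at hfloor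
  -- the zero label lies in the window
  have hw0 : (2 * Real.pi / (L : ℝ)) ^ 2 *
      (∑ i : Fin 2, ((((0 : Fin 2 → ZMod L) i).valMinAbs : ℤ) : ℝ) ^ 2) ≤ ε ^ 2 := by
    have h0 : ∀ i : Fin 2, ((((0 : Fin 2 → ZMod L) i).valMinAbs : ℤ) : ℝ) ^ 2 = 0 := fun i => by
      rw [Pi.zero_apply, ZMod.valMinAbs_zero, Int.cast_zero, sq, mul_zero]
    rw [Finset.sum_congr rfl fun i _ => h0 i, Finset.sum_const_zero, mul_zero]
    positivity
  rw [sum_ite_eq_add_sum_ite_ne_and _ _ (0 : Fin 2 → ZMod L) hw0, pairFieldAt_zero,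
    star_mulVec_dotProduct_mulVec] at hfloor
  change (C * ε + a) * (L : ℝ) ^ 2 ≤
    (expect ((pairField dWaveFormFactor L)ᴴ * pairField dWaveFormFactor L) ψ).re / (L : ℝ) ^ 2 +
      (∑ m : Fin 2 → ZMod L,
        if m ≠ 0 ∧
            (2 * Real.pi / (L : ℝ)) ^ 2 * (∑ i : Fin 2, (((m i).valMinAbs : ℤ) : ℝ) ^ 2) ≤ ε ^ 2 then
          (star (Matrix.mulVec (pairFieldAt dWaveFormFactor L m) ψ) ⬝ᵥ
              Matrix.mulVec (pairFieldAt dWaveFormFactor L m) ψ).re / (L : ℝ) ^ 2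
        else 0) at hfloor
  set X := (expect ((pairField dWaveFormFactor L)ᴴ * pairField dWaveFormFactor L) ψ).re with hX
  have h2 : a * (L : ℝ) ^ 2 ≤ X / (L : ℝ) ^ 2 := by nlinarith [hfloor, htail, hε.1]
  rw [le_div_iff₀ hL2] at h2
  calc a * (L : ℝ) ^ 4 = a * (L : ℝ) ^ 2 * (L : ℝ) ^ 2 := by ring
    _ ≤ X := h2

/-- **Floor + tail at one point ⇒ the summit.** At `U > 0`, `δ ∈ (0, 1/2)`: the window floor and
the sibling crux's window tail bound give every-GS `d`-wave LRO
(`everyGSOrderAt_of_windowFloorAt_of_wibAt`), and the even-side `liminf` bookkeeping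
`summitMatrix_of_everyGSOrder` gives `HubbardSuperconductivity`. This is the deciding theorem of the
one-point restatement `FloorPoint := ∃ (U, δ), floor ∧ tail` (census R1′ combined with the
sibling's R1). Scalapino, Phys. Rep. 250 (1995) §2 (2.4). [folklore] -/
theorem hubbardSuperconductivity_of_windowFloorAt_of_wibAt {U δ : ℝ} (hU : 0 < U)
    (hδ : δ ∈ Set.Ioo (0 : ℝ) (1 / 2))
    (hF : ∀ C : ℝ, 0 ≤ C → ∀ ε₀ : ℝ, 0 < ε₀ → ∃ ε ∈ Set.Ioc (0 : ℝ) ε₀, ∃ a : ℝ, 0 < a ∧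
      ∃ L₀ : ℕ, ∀ (L : ℕ) [NeZero L], L₀ ≤ L → Even L →
        ∀ ψ : Fock (Orb (FermionTorus 2 L)), star ψ ⬝ᵥ ψ = 1 →
          IsGroundStateInSector (hubbardTorus 2 L 1 U) (2 * ⌊(1 - δ) * (L : ℝ) ^ 2 / 2⌋₊) 0 ψ →
            (C * ε + a) * (L : ℝ) ^ 2 ≤ (star ψ ⬝ᵥ (∑ m : Fin 2 → ZMod L,
              if (2 * Real.pi / (L : ℝ)) ^ 2 * (∑ i : Fin 2, (((m i).valMinAbs : ℤ) : ℝ) ^ 2) ≤ ε ^ 2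
              then ((L : ℂ) ^ 2)⁻¹ • (Matrix.conjTranspose (pairFieldAt dWaveFormFactor L m) *
                pairFieldAt dWaveFormFactor L m)
              else 0) *ᵥ ψ).re)
    (hW : ∃ C ε₀ : ℝ, 0 ≤ C ∧ 0 < ε₀ ∧ ∃ L₀ : ℕ, ∀ ε ∈ Set.Ioc (0 : ℝ) ε₀, ∀ (L : ℕ) [NeZero L],
      L₀ ≤ L → Even L → ∀ ψ : Fock (Orb (FermionTorus 2 L)), star ψ ⬝ᵥ ψ = 1 →
        IsGroundStateInSector (hubbardTorus 2 L 1 U) (2 * ⌊(1 - δ) * (L : ℝ) ^ 2 / 2⌋₊) 0 ψ →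
          (∑ m : Fin 2 → ZMod L,
            if m ≠ 0 ∧
                (2 * Real.pi / (L : ℝ)) ^ 2 * (∑ i : Fin 2, (((m i).valMinAbs : ℤ) : ℝ) ^ 2) ≤ ε ^ 2 then
              (star (Matrix.mulVec (pairFieldAt dWaveFormFactor L m) ψ) ⬝ᵥ
                  Matrix.mulVec (pairFieldAt dWaveFormFactor L m) ψ).re / (L : ℝ) ^ 2
            else 0) ≤ C * ε * (L : ℝ) ^ 2) :
    _root_.HubbardSuperconductivity :=
  ⟨U, hU, δ, hδ, summitMatrix_of_everyGSOrder (everyGSOrderAt_of_windowFloorAt_of_wibAt hF hW)⟩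

/-- **The route closes from the FLOOR: (floor at some `U > 0`, `δ ∈ (0,1/2)`) → `WindowInfraredBound`
→ `HubbardSuperconductivity`.** Compare the route's certified
`closes (hGap : WindowGap) (hIR : WindowInfraredBound) (hTS : TargetImpliesSummit)`: by
`exists_windowFloorAt_of_windowGap` the present theorem is the same deciding theorem with a WEAKER
first binder — the penalised-energy form of the crux (its robustness / stiffness half) is never
used toward the summit (census D7 / R1′: the glue of the proposed restated crux `WindowFloor`).
Scalapino, Phys. Rep. 250 (1995) §2 (2.4). [folklore] -/
theorem hubbardSuperconductivity_of_exists_windowFloorAt_of_wib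
    (hF : ∃ U : ℝ, 0 < U ∧ ∃ δ ∈ Set.Ioo (0 : ℝ) (1 / 2),
      ∀ C : ℝ, 0 ≤ C → ∀ ε₀ : ℝ, 0 < ε₀ → ∃ ε ∈ Set.Ioc (0 : ℝ) ε₀, ∃ a : ℝ, 0 < a ∧
        ∃ L₀ : ℕ, ∀ (L : ℕ) [NeZero L], L₀ ≤ L → Even L →
          ∀ ψ : Fock (Orb (FermionTorus 2 L)), star ψ ⬝ᵥ ψ = 1 →
            IsGroundStateInSector (hubbardTorus 2 L 1 U) (2 * ⌊(1 - δ) * (L : ℝ) ^ 2 / 2⌋₊) 0 ψ →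
              (C * ε + a) * (L : ℝ) ^ 2 ≤ (star ψ ⬝ᵥ (∑ m : Fin 2 → ZMod L,
                if (2 * Real.pi / (L : ℝ)) ^ 2 * (∑ i : Fin 2, (((m i).valMinAbs : ℤ) : ℝ) ^ 2) ≤ ε ^ 2
                then ((L : ℂ) ^ 2)⁻¹ • (Matrix.conjTranspose (pairFieldAt dWaveFormFactor L m) *
                  pairFieldAt dWaveFormFactor L m)
                else 0) *ᵥ ψ).re)
    (hI : WindowInfraredBound) : _root_.HubbardSuperconductivity := by
  obtain ⟨U, hU, δ, hδ, hFl⟩ := hF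
  exact hubbardSuperconductivity_of_windowFloorAt_of_wibAt hU hδ hFl (hI U hU δ hδ)

/-! ### The floor is a consequence of every-GS order; given the tail bound it IS the summit -/

/-- **Every-GS LRO at `(U, δ)` ⇒ window floor at `(U, δ)`.** Given the order constant `c`, serve
`(C, ε₀)` with `ε := min ε₀ (c/(2C+1))` (so `Cε ≤ c/2`) and `a := c/2`: the window weight dominates
its zero mode, `Re ⟨ψ, W_ε ψ⟩ ≥ Re ⟨ψ, Δ_dᴴ Δ_d ψ⟩ / L² ≥ c L² ≥ (Cε + a) L²`
(`re_expect_pairField_div_le_re_dotProduct_kacWindow_mulVec`). So the floor is implied by the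
summit's matrix at the point (`summitMatrix_iff_everyGSOrder`). Scalapino (1995) §2. [folklore] -/
theorem windowFloorAt_of_everyGSOrderAt {U δ : ℝ}
    (h : ∃ c : ℝ, 0 < c ∧ ∃ L₀ : ℕ, ∀ (L : ℕ) [NeZero L], L₀ ≤ L → Even L →
      ∀ ψ : Fock (Orb (FermionTorus 2 L)), star ψ ⬝ᵥ ψ = 1 →
        IsGroundStateInSector (hubbardTorus 2 L 1 U) (2 * ⌊(1 - δ) * (L : ℝ) ^ 2 / 2⌋₊) 0 ψ →
          c * (L : ℝ) ^ 4 ≤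
            (expect ((pairField dWaveFormFactor L)ᴴ * pairField dWaveFormFactor L) ψ).re) :
    ∀ C : ℝ, 0 ≤ C → ∀ ε₀ : ℝ, 0 < ε₀ → ∃ ε ∈ Set.Ioc (0 : ℝ) ε₀, ∃ a : ℝ, 0 < a ∧
      ∃ L₀ : ℕ, ∀ (L : ℕ) [NeZero L], L₀ ≤ L → Even L →
        ∀ ψ : Fock (Orb (FermionTorus 2 L)), star ψ ⬝ᵥ ψ = 1 →
          IsGroundStateInSector (hubbardTorus 2 L 1 U) (2 * ⌊(1 - δ) * (L : ℝ) ^ 2 / 2⌋₊) 0 ψ →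
            (C * ε + a) * (L : ℝ) ^ 2 ≤ (star ψ ⬝ᵥ (∑ m : Fin 2 → ZMod L,
              if (2 * Real.pi / (L : ℝ)) ^ 2 * (∑ i : Fin 2, (((m i).valMinAbs : ℤ) : ℝ) ^ 2) ≤ ε ^ 2
              then ((L : ℂ) ^ 2)⁻¹ • (Matrix.conjTranspose (pairFieldAt dWaveFormFactor L m) *
                pairFieldAt dWaveFormFactor L m)
              else 0) *ᵥ ψ).re := by
  obtain ⟨c, hc, L₀, hL⟩ := h
  intro C hC ε₀ hε₀
  have hden : (0 : ℝ) < 2 * C + 1 := by linarith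
  have hq : 0 < c / (2 * C + 1) := div_pos hc hden
  set ε : ℝ := min ε₀ (c / (2 * C + 1)) with hεdef
  have hεpos : 0 < ε := lt_min hε₀ hq
  have hεε₀ : ε ≤ ε₀ := min_le_left _ _
  have hεq : ε ≤ c / (2 * C + 1) := min_le_right _ _
  have hCε : C * ε ≤ c / 2 := by
    have h1 : C * ε ≤ C * (c / (2 * C + 1)) := mul_le_mul_of_nonneg_left hεq hC
    have h2 : C * (c / (2 * C + 1)) ≤ c / 2 := by
      rw [mul_div_assoc', div_le_div_iff₀ hden two_pos]
      nlinarith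
    linarith
  refine ⟨ε, ⟨hεpos, hεε₀⟩, c / 2, half_pos hc, L₀, fun L _ hL₀ hE ψ hψ1 hψ => ?_⟩
  have hLpos : (0 : ℝ) < (L : ℝ) := Nat.cast_pos.2 (Nat.pos_of_ne_zero (NeZero.ne L))
  have hL2 : (0 : ℝ) < (L : ℝ) ^ 2 := by positivity
  have hlro := hL L hL₀ hE ψ hψ1 hψ
  have hdom := re_expect_pairField_div_le_re_dotProduct_kacWindow_mulVec L ε ψ
  have h1 : c * (L : ℝ) ^ 2 ≤
      (expect ((pairField dWaveFormFactor L)ᴴ * pairField dWaveFormFactor L) ψ).re / (L : ℝ) ^ 2 := by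
    rw [le_div_iff₀ hL2]
    calc c * (L : ℝ) ^ 2 * (L : ℝ) ^ 2 = c * (L : ℝ) ^ 4 := by ring
      _ ≤ _ := hlro
  have h2 : (C * ε + c / 2) * (L : ℝ) ^ 2 ≤ c * (L : ℝ) ^ 2 :=
    mul_le_mul_of_nonneg_right (by linarith) hL2.le
  exact h2.trans (h1.trans hdom)

/-- **Given the sibling crux's body at the point, FLOOR ⇔ the summit's matrix at `(U, δ)`**
(`δ ≥ −1`; `everyGSOrderAt_of_windowFloorAt_of_wibAt`, `windowFloorAt_of_everyGSOrderAt` and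
`summitMatrix_iff_everyGSOrder`). So, modulo crux `WindowInfraredBound` at the point, the
floor is the summit there — neither weaker nor stronger — and
`WindowGap = (summit at the point) ∧ (window stiffness)` (census D7). Tasaki (2020) §2.1;
Friedli–Velenik (2017) §3.7.2. [folklore] -/
theorem windowFloorAt_iff_summitMatrix_of_wibAt {U δ : ℝ} (hδ : -1 ≤ δ)
    (hW : ∃ C ε₀ : ℝ, 0 ≤ C ∧ 0 < ε₀ ∧ ∃ L₀ : ℕ, ∀ ε ∈ Set.Ioc (0 : ℝ) ε₀, ∀ (L : ℕ) [NeZero L],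
      L₀ ≤ L → Even L → ∀ ψ : Fock (Orb (FermionTorus 2 L)), star ψ ⬝ᵥ ψ = 1 →
        IsGroundStateInSector (hubbardTorus 2 L 1 U) (2 * ⌊(1 - δ) * (L : ℝ) ^ 2 / 2⌋₊) 0 ψ →
          (∑ m : Fin 2 → ZMod L,
            if m ≠ 0 ∧
                (2 * Real.pi / (L : ℝ)) ^ 2 * (∑ i : Fin 2, (((m i).valMinAbs : ℤ) : ℝ) ^ 2) ≤ ε ^ 2 then
              (star (Matrix.mulVec (pairFieldAt dWaveFormFactor L m) ψ) ⬝ᵥ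
                  Matrix.mulVec (pairFieldAt dWaveFormFactor L m) ψ).re / (L : ℝ) ^ 2
            else 0) ≤ C * ε * (L : ℝ) ^ 2) :
    (∀ C : ℝ, 0 ≤ C → ∀ ε₀ : ℝ, 0 < ε₀ → ∃ ε ∈ Set.Ioc (0 : ℝ) ε₀, ∃ a : ℝ, 0 < a ∧
      ∃ L₀ : ℕ, ∀ (L : ℕ) [NeZero L], L₀ ≤ L → Even L →
        ∀ ψ : Fock (Orb (FermionTorus 2 L)), star ψ ⬝ᵥ ψ = 1 →
          IsGroundStateInSector (hubbardTorus 2 L 1 U) (2 * ⌊(1 - δ) * (L : ℝ) ^ 2 / 2⌋₊) 0 ψ →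
            (C * ε + a) * (L : ℝ) ^ 2 ≤ (star ψ ⬝ᵥ (∑ m : Fin 2 → ZMod L,
              if (2 * Real.pi / (L : ℝ)) ^ 2 * (∑ i : Fin 2, (((m i).valMinAbs : ℤ) : ℝ) ^ 2) ≤ ε ^ 2
              then ((L : ℂ) ^ 2)⁻¹ • (Matrix.conjTranspose (pairFieldAt dWaveFormFactor L m) *
                pairFieldAt dWaveFormFactor L m)
              else 0) *ᵥ ψ).re) ↔
    (∀ (N : ℕ → ℕ) (ψ : ∀ L, Fock (Orb (FermionTorus 2 L))),
      (∀ L, Even L → N L = 2 * ⌊(1 - δ) * (L : ℝ) ^ 2 / 2⌋₊ ∧ star (ψ L) ⬝ᵥ ψ L = 1 ∧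
          IsGroundStateInSector (hubbardTorus 2 L 1 U) (N L) 0 (ψ L)) →
        HasLongRangeOrder (fun k => halfOpenBox 2 (2 * k))
          (fun k => torusPullback (pairFieldCorr dWaveFormFactor ψ) (2 * k))) := by
  rw [summitMatrix_iff_everyGSOrder hδ]
  exact ⟨fun hF => everyGSOrderAt_of_windowFloorAt_of_wibAt hF hW, windowFloorAt_of_everyGSOrderAt⟩

/-! ### S7 — the two-regime (kink) profile implies the crux -/

/-- **S7: the two-regime profile implies `WindowGap`.** Suppose at some `U > 0`, `δ ∈ (0, 1/2)` there
are a condensate density `m > 0`, a window stiffness `κ > 0` and `λ₀ > 0` such that for every tail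
allowance `C ≥ 0` some `ε₁ > 0` makes, for every `ε ∈ (0, ε₁]` and EVERY `λ ∈ (0, λ₀]`, eventually
in even `L`, `λ · min m (κ ε²/λ) · L² ≤ (minEnergyOn (H_L + λW_ε) K_L − minEnergyOn H_L K_L) + λ C ε L²`
(the concave penalised-gap profile up to the level crossing `λ_c ≍ κε²/m`). Then the crux holds:
only the small-`λ` corner is used (`λ := min λ₀ (κε²/m)`, `a := m/2`, `ε ≤ m/(4C+1)` so that
`m − Cε ≥ Cε + m/2`). Kernel-checked so that the census statement "S7 is a genuine strengthening
whose extra content is the plateau `κε²` = the stiffness" is exact. [folklore] -/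
theorem windowGap_of_twoRegimeProfile
    (h : ∃ U : ℝ, 0 < U ∧ ∃ δ ∈ Set.Ioo (0 : ℝ) (1 / 2), ∃ m κ lam₀ : ℝ, 0 < m ∧ 0 < κ ∧ 0 < lam₀ ∧
      ∀ C : ℝ, 0 ≤ C → ∃ ε₁ : ℝ, 0 < ε₁ ∧ ∀ ε ∈ Set.Ioc (0 : ℝ) ε₁, ∀ lam ∈ Set.Ioc (0 : ℝ) lam₀,
        ∃ L₀ : ℕ, ∀ (L : ℕ) [NeZero L], L₀ ≤ L → Even L →
          lam * min m (κ * ε ^ 2 / lam) * (L : ℝ) ^ 2 ≤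
            (hubbardTorus 2 L 1 U + (lam : ℂ) • (∑ m : Fin 2 → ZMod L,
                if (2 * Real.pi / (L : ℝ)) ^ 2 * (∑ i : Fin 2, (((m i).valMinAbs : ℤ) : ℝ) ^ 2) ≤ ε ^ 2
                then ((L : ℂ) ^ 2)⁻¹ • (Matrix.conjTranspose (pairFieldAt dWaveFormFactor L m) *
                  pairFieldAt dWaveFormFactor L m)
                else 0)).minEnergyOn (szSector (2 * ⌊(1 - δ) * (L : ℝ) ^ 2 / 2⌋₊) 0) -
              (hubbardTorus 2 L 1 U).minEnergyOn (szSector (2 * ⌊(1 - δ) * (L : ℝ) ^ 2 / 2⌋₊) 0) +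
            lam * (C * ε) * (L : ℝ) ^ 2) :
    WindowGap := by
  obtain ⟨U, hU, δ, hδ, m, κ, lam₀, hm, hκ, hlam₀, h⟩ := h
  refine ⟨U, hU, δ, hδ, fun C hC ε₀ hε₀ => ?_⟩
  obtain ⟨ε₁, hε₁, h⟩ := h C hC
  have hden : (0 : ℝ) < 4 * C + 1 := by linarith
  have hq : 0 < m / (4 * C + 1) := div_pos hm hden
  set ε : ℝ := min (min ε₀ ε₁) (m / (4 * C + 1)) with hεdef
  have hεpos : 0 < ε := lt_min (lt_min hε₀ hε₁) hq
  have hεε₀ : ε ≤ ε₀ := (min_le_left _ _).trans (min_le_left _ _)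
  have hεε₁ : ε ≤ ε₁ := (min_le_left _ _).trans (min_le_right _ _)
  have hεq : ε ≤ m / (4 * C + 1) := min_le_right _ _
  have hCε : C * ε ≤ m / 4 := by
    have h1 : C * ε ≤ C * (m / (4 * C + 1)) := mul_le_mul_of_nonneg_left hεq hC
    have h2 : C * (m / (4 * C + 1)) ≤ m / 4 := by
      rw [mul_div_assoc', div_le_div_iff₀ hden (by norm_num : (0:ℝ) < 4)]
      nlinarith
    linarith
  have hκε : 0 < κ * ε ^ 2 / m := div_pos (mul_pos hκ (pow_pos hεpos 2)) hm
  set lam : ℝ := min lam₀ (κ * ε ^ 2 / m) with hlamdef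
  have hlam : 0 < lam := lt_min hlam₀ hκε
  have hlamle : lam ≤ lam₀ := min_le_left _ _
  have hlamκ : lam ≤ κ * ε ^ 2 / m := min_le_right _ _
  obtain ⟨L₀, hL⟩ := h ε ⟨hεpos, hεε₁⟩ lam ⟨hlam, hlamle⟩
  refine ⟨ε, ⟨hεpos, hεε₀⟩, lam, m / 2, hlam, half_pos hm, L₀, fun L _ hL₀ hE => ?_⟩
  have hineq := hL L hL₀ hE
  have hmin : min m (κ * ε ^ 2 / lam) = m := by
    refine min_eq_left ?_
    rw [le_div_iff₀ hlam]
    calc m * lam ≤ m * (κ * ε ^ 2 / m) := mul_le_mul_of_nonneg_left hlamκ hm.le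
      _ = κ * ε ^ 2 := by field_simp
  rw [hmin] at hineq
  have hL2 : (0 : ℝ) ≤ (L : ℝ) ^ 2 := by positivity
  have hkey : lam * (C * ε + m / 2) * (L : ℝ) ^ 2 ≤
      lam * m * (L : ℝ) ^ 2 - lam * (C * ε) * (L : ℝ) ^ 2 := by
    have : lam * (C * ε + m / 2) ≤ lam * m - lam * (C * ε) := by nlinarith
    nlinarith
  -- the crux's `let D` / `let W` are `pairFieldAt` / the spelled-out window by `rfl`
  show lam * (C * ε + m / 2) * (L : ℝ) ^ 2 ≤
    (hubbardTorus 2 L 1 U + (lam : ℂ) • (∑ m : Fin 2 → ZMod L,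
        if (2 * Real.pi / (L : ℝ)) ^ 2 * (∑ i : Fin 2, (((m i).valMinAbs : ℤ) : ℝ) ^ 2) ≤ ε ^ 2
        then ((L : ℂ) ^ 2)⁻¹ • (Matrix.conjTranspose (pairFieldAt dWaveFormFactor L m) *
          pairFieldAt dWaveFormFactor L m)
        else 0)).minEnergyOn (szSector (2 * ⌊(1 - δ) * (L : ℝ) ^ 2 / 2⌋₊) 0) -
      (hubbardTorus 2 L 1 U).minEnergyOn (szSector (2 * ⌊(1 - δ) * (L : ℝ) ^ 2 / 2⌋₊) 0)
  linarith

end Summit.HubbardSuperconductivity.HubbardSuperconductivity.Theorems
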